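import Mathlib
import Summits.QuantumFields.YangMills.Theses.LangevinControlUV

/-!
# Sketch — crux-ideate stmt-QuantumFields-9367 (OSLegsFromFemtoAndGap), ideator 1, round 1

First lemmas of the two idea cards (statements must elaborate; proofs not required).

* Card `dlr-collar-transfer`: `collar_cov_bound` (abstract law-of-total-covariance bound under
  conditional independence) and the typable lattice primitive `FemtoBoundaryLaw` (conditional-mean
  decay of the plaquette given the links outside a box, uniformly in the exterior configuration).
* Card `hankel-rope`: `rope_interpolation` (discrete log-convex interpolation) and
  `axisCov_logConvex` (Hankel/RP log-convexity of the spatial-plaquette time correlator on the torus).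
-/

open MeasureTheory ProbabilityTheory Filter Topology

namespace Summit.QuantumFields.YangMills.Cruxes.OSLegsFromFemtoAndGap.IdeatorOne

/-! ## Card dlr-collar-transfer -/

/-- **First lemma (abstract collar bound).** If `X`, `Y` are bounded, conditionally independent
given `m`, and their conditional means deviate from their means by at most `εX`, `εY` a.e., then
`|Cov(X,Y)| ≤ εX · εY`.  (Law of total covariance: `Cov(X,Y) = E[(E[X|m]-EX)(E[Y|m]-EY)]`.) -/
theorem collar_cov_bound {Ω : Type*} {mΩ : MeasurableSpace Ω} [StandardBorelSpace Ω]
    (μ : Measure Ω) [IsProbabilityMeasure μ] (m : MeasurableSpace Ω) (hm : m ≤ mΩ)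
    (X Y : Ω → ℝ) (hX : Measurable X) (hY : Measurable Y) (bX bY εX εY : ℝ)
    (hbX : ∀ ω, |X ω| ≤ bX) (hbY : ∀ ω, |Y ω| ≤ bY)
    (hind : CondIndepFun m hm X Y μ)
    (hεX : ∀ᵐ ω ∂μ, |(μ[X|m]) ω - ∫ ω', X ω' ∂μ| ≤ εX)
    (hεY : ∀ᵐ ω ∂μ, |(μ[Y|m]) ω - ∫ ω', Y ω' ∂μ| ≤ εY) :
    |∫ ω, X ω * Y ω ∂μ - (∫ ω, X ω ∂μ) * (∫ ω, Y ω ∂μ)| ≤ εX * εY := by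
  sorry

open Literature.MathematicalPhysics.QuantumFieldTheory in
/-- The σ-algebra generated by the links OUTSIDE the edge set `E₀` (the "exterior" of a box whose
interior links are `E₀`). -/
@[reducible] def exteriorSigma {L : ℕ} (G : Type) [MeasurableSpace G] (E₀ : Set (Edge 4 L)) :
    MeasurableSpace (GaugeConfig 4 L G) :=
  MeasurableSpace.comap (fun (U : GaugeConfig 4 L G) (e : {e : Edge 4 L // e ∉ E₀}) => U e.1)
    inferInstance

open Literature.MathematicalPhysics.QuantumFieldTheory in
/-- Interior links of the axis-parallel box of side `b` based at `c`: edges `(x,i)` with both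
endpoints in `{x | ∀ j, (x j - c j).val < b}`. -/
def boxEdges {L : ℕ} [NeZero L] (c : Fin 4 → ZMod L) (b : ℕ) : Set (Edge 4 L) :=
  {e | (∀ j, ((e.1 j - c j).val) < b) ∧ ∀ j, (((e.1 + Pi.single e.2 (1 : ZMod L) : Fin 4 → ZMod L) j - c j).val) < b}

open Literature.MathematicalPhysics.QuantumFieldTheory in
/-- Lattice (sup-norm) distance from a site `x` to the complement of the box `(c,b)`. -/
def depth {L : ℕ} [NeZero L] (c : Fin 4 → ZMod L) (b : ℕ) (x : Fin 4 → ZMod L) : ℕ :=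
  Finset.univ.inf' Finset.univ_nonempty fun j : Fin 4 => min ((x j - c j).val + 1) (b - (x j - c j).val)

open Literature.MathematicalPhysics.QuantumFieldTheory in
/-- **FemtoBoundaryLaw (FBL-i), typable primitive of the line.** For the unit map `a`: there are
`C, β₀', ℓ₀'` and a reference plaquette mean `p : ℝ → ℝ` such that on EVERY torus `(ℤ/L)⁴`, for
every femto box (side `b`, `b·a(β) ≤ ℓ₀'`) and every site `x` of depth `d ≥ 1` in it, the
conditional expectation of the plaquette `P_x^{(ij)}` given all links outside the box deviates
from `p β` by at most `C/d⁴`, almost surely (i.e. uniformly in the exterior configuration up to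
null sets).  Dimension-4 decay = scaling dimension of `tr F²`; compactness of `G` caps the flux a
boundary can force through the box. -/
def FemtoBoundaryLaw (a : ℝ → ℝ) : Prop :=
  ∀ (G : Type) [Group G] [TopologicalSpace G] [IsTopologicalGroup G] [CompactSpace G],
    IsCompactSimpleLieGroup G →
      letI : MeasurableSpace G := borel G
      haveI : BorelSpace G := ⟨rfl⟩
      ∀ (r : LatticeRep G), ∃ (C β₀' ℓ₀' : ℝ) (p : ℝ → ℝ), 0 < ℓ₀' ∧
        ∀ (L : ℕ) [NeZero L] (β : ℝ), β₀' ≤ β →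
          ∀ (c : Fin 4 → ZMod L) (b : ℕ), (b : ℝ) * a β ≤ ℓ₀' → 2 * b < L →
            ∀ (x : Fin 4 → ZMod L) (i j : Fin 4), i ≠ j → 1 ≤ depth c b x →
              let P : GaugeConfig 4 L G → ℝ := fun U => (r.N : ℝ) - (r.ρ (plaquetteHolonomy U x i j)).trace.re
              ∀ᵐ U ∂(wilsonMeasure (d := 4) (L := L) r.ρ β),
                |((wilsonMeasure (d := 4) (L := L) r.ρ β)[P | exteriorSigma G (boxEdges c b)]) U - p β|
                  ≤ C / (depth c b x : ℝ) ^ 4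

/-! ## Card hankel-rope -/

/-- **First lemma (discrete log-convex rope).** A nonnegative sequence, discretely log-convex on
`[n₁, n₂]`, bounded by `A` at `n₁` and by `A θ^(n₂-n₁)` at `n₂` (`0 < θ ≤ 1`), is bounded by
`A θ^(n-n₁)` throughout: exponential decay is INTERPOLATED between a UV anchor and an IR anchor. -/
theorem rope_interpolation (u : ℕ → ℝ) (n₁ n₂ : ℕ) (A θ : ℝ) (hA : 0 ≤ A) (hθ : 0 < θ)
    (hθ1 : θ ≤ 1) (h12 : n₁ ≤ n₂)
    (hpos : ∀ n, n₁ ≤ n → n ≤ n₂ → 0 ≤ u n)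
    (hconv : ∀ n, n₁ < n → n < n₂ → u n ^ 2 ≤ u (n - 1) * u (n + 1))
    (h₁ : u n₁ ≤ A) (h₂ : u n₂ ≤ A * θ ^ (n₂ - n₁)) :
    ∀ n, n₁ ≤ n → n ≤ n₂ → u n ≤ A * θ ^ (n - n₁) := by
  sorry

open Literature.MathematicalPhysics.QuantumFieldTheory in
/-- **Hankel log-convexity of the axis correlator (statement).** On the periodic torus `(ℤ/L)⁴`,
`L` even, `β ≥ 0`, the connected time-correlator `cov n` of the spatial plaquette `P^{(12)}`
(shift by `n e₀`) is nonnegative and discretely log-convex for `1 ≤ n`, `n + 1 ≤ L/2`: the Gram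
matrices of the link- and site-reflection OS forms (tree: `wilsonExpectation_reflectionPositive_holds`,
`wilsonExpectation_siteReflectionPositive`) are Hankel in the time labels. -/
theorem axisCov_logConvex (G : Type) [Group G] [TopologicalSpace G] [IsTopologicalGroup G]
    [CompactSpace G] [MeasurableSpace G] [BorelSpace G] (r : LatticeRep G) (L : ℕ) [NeZero L]
    (hL : Even L) (β : ℝ) (hβ : 0 ≤ β) :
    let P : (Fin 4 → ZMod L) → GaugeConfig 4 L G → ℝ :=
      fun x U => (r.N : ℝ) - (r.ρ (plaquetteHolonomy U x 1 2)).trace.re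
    let E : (GaugeConfig 4 L G → ℝ) → ℝ := fun F => wilsonExpectation (d := 4) (L := L) r.ρ β F
    let cov : ℕ → ℝ := fun n =>
      E (fun U => P 0 U * P (Pi.single (0 : Fin 4) ((n : ℕ) : ZMod L)) U) -
        E (P 0) * E (P (Pi.single (0 : Fin 4) ((n : ℕ) : ZMod L)))
    (∀ n : ℕ, 2 * n ≤ L → 0 ≤ cov n) ∧
      ∀ n : ℕ, 1 ≤ n → 2 * (n + 1) ≤ L → cov n ^ 2 ≤ cov (n - 1) * cov (n + 1) := by
  sorry

end Summit.QuantumFields.YangMills.Cruxes.OSLegsFromFemtoAndGap.IdeatorOne
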